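import Summits.ResolutionOfSingularities.ResolutionOfSingularities.Theorems.FrobeniusLadderFInjectiveMacaulayficationFilteredReesCarrier
import Literature.AlgebraicGeometry.Resolution.AffineBlowupAlgebra
import Mathlib.RingTheory.Localization.Away.Basic
import Mathlib.RingTheory.Ideal.Quotient.Operations
import HarnessLib

/-!
# (F2a) The substitution `s ↦ 1` and degree bookkeeping for the filtered chart isomorphism (crux `FInjectiveMacaulayfication`, §17 G4♮)

Support file for crux stmt-ResolutionOfSingularities-15315 (`FrobeniusLadder.FInjectiveMacaulayfication`), §17 THE FILTERED
ENGINE G4♮ `stub_filteredChartClause` (skeleton v13 `45d06e4e`, CRUX-PLAN w45a v5/v6 §1.2 piece (F2); lead seat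
res-L1-w45a-lead-1, in the shape requested by res-L1-w45a-stub-4 02:51:50Z). [OURS · L1 W4.5a]

Setting (stub-3's carrier `FilteredReesCarrier`, p488836): `f ∈ k[X₁..Xₙ]` arbitrary with `D = ord_w f`
(`hD0`), `f^h = Σ_b c_b X^b s^{w·b − D} ∈ k[X, s]` (`hfh`, `s = X none`, `X_j = X (some j)`), `ℛ = k[X,s]/(f^h)`,
`T′♮ = ℛ[1/X_v^c]`, weights `(w, −1)`, `N = c·w_v`, and a COACTION `β : T′♮ → T′♮[T;T⁻¹]` known only through
(i) its values on classes of weighted homogeneous polynomials and (ii) the counit `β(b)(1) = b` (conjuncts 3–4 of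
`WeightCoactionZ.exists_weightCoactionZ`, p-id stub-4); `T₀ ⊆ T′♮` the degree-`0` subalgebra (`b ∈ T₀ ↔ β b = single 0 b`,
`RingVeronese.exists_degSubalgebra`). On the other side `R = k[X]/(f)`, `u = x̄_v^c`, `L = R[1/u]`, and the weighted blow-up
chart `C_v = R[I_N R/u] ⊆ L` (`I_N` = monomials of weight `≥ N`, Veronese saturation `hpow`).

THE ISOMORPHISM. Substituting `s ↦ 1` gives `ψ : T′♮ → L` (`f^h(X,1) = f`, `FilteredReesCarrier.aeval_one_fh`). A degree-`0`
element of `T′♮` is a sum of monomial fractions `X^e s^t / X_v^{cj}` with `w·e − t = jN` (`eq_sum_degZero`), so `ψ` maps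
`T₀` into `C_v` (`w·e ≥ jN` and saturation), onto `C_v` (the generators `x̄_j = ψ(X_j s^{w_j})`, `x̄^b/u = ψ(X^b s^{w·b−N}/X_v^c)`
have degree-`0` preimages), and injectively: if `Σ c_e x̄^e = 0` in `R` then `Σ c_e X^e = g f`, and twisting `X_j ↦ X_j s^{w_j}`
gives `s^{jN} · (Σ c_e X^e s^t) = g^tw · s^D f^h ∈ (f^h)`, whence the numerator lies in the PRIME `(f^h) ∌ s`. So
`ι♮ := (ψ|_{T₀})⁻¹ : C_v ≃+* T₀`, with `ι♮(u) = (X_v^c/1)·(s/1)^N`.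
This file (F2a) holds the PREPARATION: exponent bookkeeping on `Option (Fin n)`, the twist `X_j ↦ X_j s^{w_j}`
(`twist_f : f(X_j s^{w_j}) = s^D f^h`), the substitution `ψ` (`exists_substOne`), and the coaction side (`coaction_term`,
`eq_sum_of_degZero`); the isomorphism itself is assembled in `FilteredChartIso` (F2b).
No definitions, no named facts. [folklore: deformation to the weighted tangent cone]
-/

set_option linter.dupNamespace false

noncomputable section

open scoped LaurentPolynomial
open AddMonoidAlgebra LaurentPolynomial Literature.AlgebraicGeometry.Resolution

namespace Summit.ResolutionOfSingularities.ResolutionOfSingularities.Theorems.FInjectiveMacaulayfication.FilteredChartSubst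

open Summit.ResolutionOfSingularities.ResolutionOfSingularities.Theorems.FInjectiveMacaulayfication

variable {k : Type} [Field k] {n : ℕ} (w : Fin n → ℕ)

/-! ## Exponent bookkeeping on `Option (Fin n)` -/

/-- An exponent vector on `Option (Fin n)` splits as its `some`-part plus its `none`-entry. [folklore] -/
theorem mapDomain_some_add_single_none (e : Option (Fin n) →₀ ℕ) :
    Finsupp.mapDomain some e.some + Finsupp.single none (e none) = e := by
  classical
  ext o
  rcases o with _ | j
  · rw [Finsupp.add_apply, Finsupp.single_eq_same, Finsupp.mapDomain_notin_range _ _ (by simp)]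
    simp
  · rw [Finsupp.add_apply, Finsupp.mapDomain_apply (Option.some_injective _), Finsupp.single_eq_of_ne (by simp),
      Finsupp.some_apply, add_zero]

/-- The `(w, −1)`-weight of an exponent vector `e` on `Option (Fin n)` is `w·(e ∘ some) − e(none)`. [folklore] -/
theorem weight_option (e : Option (Fin n) →₀ ℕ) :
    Finsupp.weight (fun o : Option (Fin n) => o.elim (-1 : ℤ) (fun j => (w j : ℤ))) e = (Finsupp.weight w e.some : ℤ) - e none := by
  conv_lhs => rw [← mapDomain_some_add_single_none e]
  exact FilteredReesCarrier.weight_carrierExponent w e.some (e none)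

/-! ## The twist `X_j ↦ X_j s^{w_j}` -/

/-- The twist on a monomial: `c X^b ↦ c X^b s^{w·b}`. [folklore] -/
theorem twist_monomial (b : Fin n →₀ ℕ) (c : k) :
    MvPolynomial.aeval (fun j : Fin n => (MvPolynomial.X (some j) : MvPolynomial (Option (Fin n)) k) *
        MvPolynomial.X none ^ (w j)) (MvPolynomial.monomial b c) =
      MvPolynomial.monomial (Finsupp.mapDomain some b + Finsupp.single none (Finsupp.weight w b)) c := by
  classical
  rw [MvPolynomial.aeval_monomial, MvPolynomial.monomial_eq, MvPolynomial.algebraMap_eq,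
    Finsupp.prod_add_index' (fun _ => pow_zero _) (fun _ _ _ => pow_add _ _ _),
    Finsupp.prod_mapDomain_index (fun _ => pow_zero _) (fun _ _ _ => pow_add _ _ _),
    Finsupp.prod_single_index (h := fun o m => (MvPolynomial.X o : MvPolynomial (Option (Fin n)) k) ^ m) (pow_zero _),
    Finsupp.weight_apply, Finsupp.prod, Finsupp.prod, Finsupp.sum]
  congr 1
  simp only [mul_pow, ← pow_mul, Finset.prod_mul_distrib, Finset.prod_pow_eq_pow_sum, smul_eq_mul, mul_comm]

variable (f : MvPolynomial (Fin n) k) (D : ℕ) (fh : MvPolynomial (Option (Fin n)) k)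
  (hfh : fh = ∑ b ∈ f.support, MvPolynomial.monomial
    (Finsupp.mapDomain some b + Finsupp.single none (Finsupp.weight w b - D)) (MvPolynomial.coeff b f))
  (hD0 : ∀ m < D, MvPolynomial.weightedHomogeneousComponent w m f = 0)

section
include hfh hD0

/-- **`f(X_j s^{w_j}) = s^D · f^h`.** [folklore] -/
theorem twist_f :
    MvPolynomial.aeval (fun j : Fin n => (MvPolynomial.X (some j) : MvPolynomial (Option (Fin n)) k) *
        MvPolynomial.X none ^ (w j)) f = MvPolynomial.X none ^ D * fh := by
  classical
  conv_lhs => rw [MvPolynomial.as_sum f]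
  rw [map_sum, hfh, Finset.mul_sum]
  refine Finset.sum_congr rfl fun b hb => ?_
  rw [twist_monomial, MvPolynomial.X_pow_eq_monomial, MvPolynomial.monomial_mul, one_mul]
  congr 1
  rw [add_left_comm, ← Finsupp.single_add, Nat.add_sub_cancel' (FilteredReesCarrier.le_weight_of_mem_support w D f hD0 hb)]

end

/-- A degree-`0` monomial `X^e` (`w·(e∘some) = e(none) + jN`) is the twist of `X^{e∘some}` divided by `s^{jN}`:
`s^{jN} · c X^e = twist (c X^{e∘some})`. [folklore] -/
theorem twist_monomial_some (e : Option (Fin n) →₀ ℕ) (c : k) (jN : ℕ) (he : Finsupp.weight w e.some = e none + jN) :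
    MvPolynomial.X none ^ jN * MvPolynomial.monomial e c =
      MvPolynomial.aeval (fun j : Fin n => (MvPolynomial.X (some j) : MvPolynomial (Option (Fin n)) k) *
        MvPolynomial.X none ^ (w j)) (MvPolynomial.monomial e.some c) := by
  rw [twist_monomial, he, MvPolynomial.X_pow_eq_monomial, MvPolynomial.monomial_mul, one_mul]
  congr 1
  conv_lhs => rw [← mapDomain_some_add_single_none e]
  rw [Finsupp.single_add, add_comm, add_assoc]

/-! ## Elements of a localised quotient; the substitution `s ↦ 1` -/

/-- Every element of `(k[X_σ]/(g))[1/ū]` is `(ā/1)·(1/ū)^j`. [folklore] -/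
theorem exists_eq_mk_mul_invSelf_pow {σ : Type} (g : MvPolynomial σ k) (ub : MvPolynomial σ k ⧸ Ideal.span {g})
    (b : Localization.Away ub) :
    ∃ (j : ℕ) (a : MvPolynomial σ k), b = algebraMap _ (Localization.Away ub)
      (Ideal.Quotient.mk (Ideal.span {g}) a) * IsLocalization.Away.invSelf ub ^ j := by
  obtain ⟨⟨r, s⟩, rfl⟩ := IsLocalization.mk'_surjective (Submonoid.powers ub) b
  obtain ⟨j, hj⟩ := (Submonoid.mem_powers_iff _ _).mp s.2
  obtain ⟨a, rfl⟩ := Ideal.Quotient.mk_surjective r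
  refine ⟨j, a, ?_⟩
  dsimp only
  rw [IsLocalization.mk'_eq_iff_eq_mul, mul_assoc, ← hj, map_pow, ← mul_pow, mul_comm (IsLocalization.Away.invSelf ub),
    IsLocalization.Away.mul_invSelf, one_pow, mul_one]

/-- The substitution `s ↦ 1` on a monomial class: `c X^e ↦ c x̄^{e∘some}/1`. [folklore] -/
theorem aeval_elim_one_monomial (u : MvPolynomial (Fin n) k ⧸ Ideal.span {f}) (e : Option (Fin n) →₀ ℕ) (c : k) :
    MvPolynomial.aeval (fun o : Option (Fin n) => o.elim (1 : Localization.Away u)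
        (fun j => algebraMap _ (Localization.Away u) (Ideal.Quotient.mk (Ideal.span {f}) (MvPolynomial.X j))))
      (MvPolynomial.monomial e c) =
      algebraMap _ (Localization.Away u) (Ideal.Quotient.mk (Ideal.span {f}) (MvPolynomial.monomial e.some c)) := by
  classical
  rw [MvPolynomial.aeval_monomial, MvPolynomial.monomial_eq, map_mul, map_mul, WeightCoaction.algebraMap_mk_C,
    Finsupp.prod_option_index (f := e) (b := fun o m => (Option.elim o (1 : Localization.Away u)
      (fun j => algebraMap _ (Localization.Away u) (Ideal.Quotient.mk (Ideal.span {f}) (MvPolynomial.X j)))) ^ m)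
      (fun _ => pow_zero _) (fun _ _ _ => pow_add _ _ _)]
  simp only [Option.elim_none, Option.elim_some, one_pow, one_mul, Finsupp.prod, map_prod, map_pow]

section
include hfh

/-- **The substitution `s ↦ 1`**, `ψ : T′♮ = (k[X,s]/(f^h))[1/X_v^c] → L = (k[X]/(f))[1/x̄_v^c]`: well defined because
`f^h(X, 1) = f` (`FilteredReesCarrier.aeval_one_fh`) and `X_v^c ↦ x̄_v^c`, a unit of `L`; it sends `1/X_v^c` to `1/x̄_v^c`.
[folklore] -/
theorem exists_substOne (v : Fin n) (c : ℕ) :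
    ∃ ψ : Localization.Away (Ideal.Quotient.mk (Ideal.span {fh}) (MvPolynomial.X (some v)) ^ c) →+*
        Localization.Away (Ideal.Quotient.mk (Ideal.span {f}) (MvPolynomial.X v) ^ c),
      (∀ a : MvPolynomial (Option (Fin n)) k, ψ (algebraMap _ _ (Ideal.Quotient.mk (Ideal.span {fh}) a)) =
        MvPolynomial.aeval (fun o : Option (Fin n) => o.elim
          (1 : Localization.Away (Ideal.Quotient.mk (Ideal.span {f}) (MvPolynomial.X v) ^ c))
          (fun j => algebraMap _ (Localization.Away (Ideal.Quotient.mk (Ideal.span {f}) (MvPolynomial.X v) ^ c))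
            (Ideal.Quotient.mk (Ideal.span {f}) (MvPolynomial.X j)))) a) ∧
      ψ (IsLocalization.Away.invSelf (Ideal.Quotient.mk (Ideal.span {fh}) (MvPolynomial.X (some v)) ^ c)) =
        IsLocalization.Away.invSelf (Ideal.Quotient.mk (Ideal.span {f}) (MvPolynomial.X v) ^ c) := by
  -- the substitution on polynomials, and why it kills `f^h`
  have hΨ : MvPolynomial.aeval (fun j : Fin n => algebraMap _ (Localization.Away (Ideal.Quotient.mk (Ideal.span {f})
      (MvPolynomial.X v) ^ c)) (Ideal.Quotient.mk (Ideal.span {f}) (MvPolynomial.X j))) =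
      (IsScalarTower.toAlgHom k (MvPolynomial (Fin n) k ⧸ Ideal.span {f}) _).comp (Ideal.Quotient.mkₐ k (Ideal.span {f})) :=
    MvPolynomial.algHom_ext fun j => by simp
  have hcomp : MvPolynomial.aeval (fun o : Option (Fin n) => o.elim
      (1 : Localization.Away (Ideal.Quotient.mk (Ideal.span {f}) (MvPolynomial.X v) ^ c))
      (fun j => algebraMap _ (Localization.Away (Ideal.Quotient.mk (Ideal.span {f}) (MvPolynomial.X v) ^ c))
        (Ideal.Quotient.mk (Ideal.span {f}) (MvPolynomial.X j)))) =
      (MvPolynomial.aeval (fun j : Fin n => algebraMap _ (Localization.Away (Ideal.Quotient.mk (Ideal.span {f})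
        (MvPolynomial.X v) ^ c)) (Ideal.Quotient.mk (Ideal.span {f}) (MvPolynomial.X j)))).comp
      (MvPolynomial.aeval (fun o : Option (Fin n) => o.elim (1 : MvPolynomial (Fin n) k) MvPolynomial.X)) :=
    MvPolynomial.algHom_ext fun o => by cases o <;> simp
  have hker : ∀ a ∈ Ideal.span {fh}, (MvPolynomial.aeval (fun o : Option (Fin n) => o.elim
      (1 : Localization.Away (Ideal.Quotient.mk (Ideal.span {f}) (MvPolynomial.X v) ^ c))
      (fun j => algebraMap _ (Localization.Away (Ideal.Quotient.mk (Ideal.span {f}) (MvPolynomial.X v) ^ c))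
        (Ideal.Quotient.mk (Ideal.span {f}) (MvPolynomial.X j))))).toRingHom a = 0 := by
    have hfh0 : MvPolynomial.aeval (fun o : Option (Fin n) => o.elim
        (1 : Localization.Away (Ideal.Quotient.mk (Ideal.span {f}) (MvPolynomial.X v) ^ c))
        (fun j => algebraMap _ (Localization.Away (Ideal.Quotient.mk (Ideal.span {f}) (MvPolynomial.X v) ^ c))
          (Ideal.Quotient.mk (Ideal.span {f}) (MvPolynomial.X j)))) fh = 0 := by
      rw [hcomp, AlgHom.comp_apply, FilteredReesCarrier.aeval_one_fh w D f fh hfh, hΨ, AlgHom.comp_apply,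
        Ideal.Quotient.mkₐ_eq_mk, Ideal.Quotient.eq_zero_iff_mem.mpr (Ideal.mem_span_singleton_self f), map_zero]
    intro a ha
    obtain ⟨q, rfl⟩ := Ideal.mem_span_singleton'.mp ha
    rw [AlgHom.toRingHom_eq_coe, RingHom.coe_coe, map_mul, hfh0, mul_zero]
  -- descend to `ℛ`, extend to `T′♮`
  have hlift_mk : ∀ a, Ideal.Quotient.lift (Ideal.span {fh}) _ hker (Ideal.Quotient.mk (Ideal.span {fh}) a) =
      MvPolynomial.aeval (fun o : Option (Fin n) => o.elim
      (1 : Localization.Away (Ideal.Quotient.mk (Ideal.span {f}) (MvPolynomial.X v) ^ c))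
      (fun j => algebraMap _ (Localization.Away (Ideal.Quotient.mk (Ideal.span {f}) (MvPolynomial.X v) ^ c))
        (Ideal.Quotient.mk (Ideal.span {f}) (MvPolynomial.X j)))) a := fun a => by
    rw [Ideal.Quotient.lift_mk]; rfl
  have hU : Ideal.Quotient.lift (Ideal.span {fh}) _ hker (Ideal.Quotient.mk (Ideal.span {fh}) (MvPolynomial.X (some v)) ^ c) =
      algebraMap _ (Localization.Away (Ideal.Quotient.mk (Ideal.span {f}) (MvPolynomial.X v) ^ c))
        (Ideal.Quotient.mk (Ideal.span {f}) (MvPolynomial.X v) ^ c) := by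
    rw [map_pow, hlift_mk, MvPolynomial.aeval_X, Option.elim_some, map_pow]
  have hunit : IsUnit (Ideal.Quotient.lift (Ideal.span {fh}) _ hker
      (Ideal.Quotient.mk (Ideal.span {fh}) (MvPolynomial.X (some v)) ^ c)) := by
    rw [hU]; exact IsLocalization.Away.algebraMap_isUnit _
  obtain ⟨ψ, hψ⟩ : ∃ ψ : Localization.Away (Ideal.Quotient.mk (Ideal.span {fh}) (MvPolynomial.X (some v)) ^ c) →+*
      Localization.Away (Ideal.Quotient.mk (Ideal.span {f}) (MvPolynomial.X v) ^ c), ψ = IsLocalization.Away.lift _ hunit := ⟨_, rfl⟩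
  have hψmk : ∀ a, ψ (algebraMap _ _ (Ideal.Quotient.mk (Ideal.span {fh}) a)) = MvPolynomial.aeval (fun o : Option (Fin n) => o.elim
      (1 : Localization.Away (Ideal.Quotient.mk (Ideal.span {f}) (MvPolynomial.X v) ^ c))
      (fun j => algebraMap _ (Localization.Away (Ideal.Quotient.mk (Ideal.span {f}) (MvPolynomial.X v) ^ c))
        (Ideal.Quotient.mk (Ideal.span {f}) (MvPolynomial.X j)))) a := fun a => by
    rw [hψ, IsLocalization.Away.lift_eq, hlift_mk]
  refine ⟨ψ, hψmk, ?_⟩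
  -- `1/X_v^c ↦ 1/x̄_v^c`
  have hψU : ψ (algebraMap _ _ (Ideal.Quotient.mk (Ideal.span {fh}) (MvPolynomial.X (some v)) ^ c)) =
      algebraMap _ (Localization.Away (Ideal.Quotient.mk (Ideal.span {f}) (MvPolynomial.X v) ^ c))
        (Ideal.Quotient.mk (Ideal.span {f}) (MvPolynomial.X v) ^ c) := by
    have h := hψmk (MvPolynomial.X (some v) ^ c)
    rw [map_pow (Ideal.Quotient.mk (Ideal.span {fh})), map_pow (MvPolynomial.aeval _), MvPolynomial.aeval_X,
      Option.elim_some] at h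
    rw [h]
    exact (map_pow _ _ _).symm
  have h1 : ψ (algebraMap _ _ (Ideal.Quotient.mk (Ideal.span {fh}) (MvPolynomial.X (some v)) ^ c)) *
      ψ (IsLocalization.Away.invSelf (Ideal.Quotient.mk (Ideal.span {fh}) (MvPolynomial.X (some v)) ^ c)) = 1 := by
    rw [← map_mul, IsLocalization.Away.mul_invSelf, map_one]
  rw [hψU] at h1
  calc ψ (IsLocalization.Away.invSelf (Ideal.Quotient.mk (Ideal.span {fh}) (MvPolynomial.X (some v)) ^ c))
      = (algebraMap _ (Localization.Away (Ideal.Quotient.mk (Ideal.span {f}) (MvPolynomial.X v) ^ c))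
          (Ideal.Quotient.mk (Ideal.span {f}) (MvPolynomial.X v) ^ c) *
          IsLocalization.Away.invSelf (Ideal.Quotient.mk (Ideal.span {f}) (MvPolynomial.X v) ^ c)) *
        ψ (IsLocalization.Away.invSelf (Ideal.Quotient.mk (Ideal.span {fh}) (MvPolynomial.X (some v)) ^ c)) := by
          rw [IsLocalization.Away.mul_invSelf, one_mul]
    _ = _ := by rw [mul_right_comm, h1, one_mul]

end

/-- Components of a carrier exponent `X^b s^t`: the `some`-part is `b`. [folklore] -/
theorem some_carrierExponent (b : Fin n →₀ ℕ) (t : ℕ) : (Finsupp.mapDomain some b + Finsupp.single none t).some = b := by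
  classical
  ext j
  rw [Finsupp.some_apply, Finsupp.add_apply, Finsupp.mapDomain_apply (Option.some_injective _),
    Finsupp.single_eq_of_ne (by simp), add_zero]

/-- Components of a carrier exponent `X^b s^t`: the `none`-entry is `t`. [folklore] -/
theorem none_carrierExponent (b : Fin n →₀ ℕ) (t : ℕ) :
    (Finsupp.mapDomain some b + Finsupp.single none t : Option (Fin n) →₀ ℕ) none = t := by
  classical
  rw [Finsupp.add_apply, Finsupp.single_eq_same, Finsupp.mapDomain_notin_range _ _ (by simp), zero_add]

/-- The twist of any polynomial is `(w, −1)`-homogeneous of weight `0`. [folklore] -/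
theorem twist_isWeightedHomogeneous_zero (a : MvPolynomial (Fin n) k) :
    MvPolynomial.IsWeightedHomogeneous (fun o : Option (Fin n) => o.elim (-1 : ℤ) (fun j => (w j : ℤ)))
      (MvPolynomial.aeval (fun j : Fin n => (MvPolynomial.X (some j) : MvPolynomial (Option (Fin n)) k) *
        MvPolynomial.X none ^ (w j)) a) 0 := by
  classical
  rw [MvPolynomial.as_sum a, map_sum]
  refine MvPolynomial.IsWeightedHomogeneous.sum _ _ _ fun b _ => ?_
  rw [twist_monomial]
  refine MvPolynomial.isWeightedHomogeneous_monomial _ _ _ ?_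
  rw [FilteredReesCarrier.weight_carrierExponent, sub_self]

/-- Substituting the classes `x̄_j/1` into a polynomial gives the class `ā/1`. [folklore] -/
theorem aeval_algebraMap_mk (f : MvPolynomial (Fin n) k) (u : MvPolynomial (Fin n) k ⧸ Ideal.span {f}) (a : MvPolynomial (Fin n) k) :
    MvPolynomial.aeval (fun j : Fin n => algebraMap _ (Localization.Away u) (Ideal.Quotient.mk (Ideal.span {f}) (MvPolynomial.X j))) a =
      algebraMap _ (Localization.Away u) (Ideal.Quotient.mk (Ideal.span {f}) a) := by
  have h : MvPolynomial.aeval (fun j : Fin n => algebraMap _ (Localization.Away u) (Ideal.Quotient.mk (Ideal.span {f})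
      (MvPolynomial.X j))) = (IsScalarTower.toAlgHom k (MvPolynomial (Fin n) k ⧸ Ideal.span {f}) _).comp
        (Ideal.Quotient.mkₐ k (Ideal.span {f})) :=
    MvPolynomial.algHom_ext fun j => by simp
  rw [h]; rfl

/-! ## The coaction side: degrees of the monomial fractions, degree-zero elements -/

section Coaction

variable (v : Fin n) (N c : ℕ) (hcN : c * w v = N)
  (β : Localization.Away (Ideal.Quotient.mk (Ideal.span {fh}) (MvPolynomial.X (some v)) ^ c) →+*
    (Localization.Away (Ideal.Quotient.mk (Ideal.span {fh}) (MvPolynomial.X (some v)) ^ c))[T;T⁻¹])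
  (hβ : ∀ (φ : MvPolynomial (Option (Fin n)) k) (d : ℤ),
    MvPolynomial.IsWeightedHomogeneous (fun o : Option (Fin n) => o.elim (-1 : ℤ) (fun j => (w j : ℤ))) φ d →
    β (algebraMap _ _ (Ideal.Quotient.mk (Ideal.span {fh}) φ)) = single d (algebraMap _ _ (Ideal.Quotient.mk (Ideal.span {fh}) φ)))

include hcN hβ

/-- `X_v^c/1` is homogeneous of degree `N`. [folklore] -/
theorem coaction_U : β (algebraMap _ _ (Ideal.Quotient.mk (Ideal.span {fh}) (MvPolynomial.X (some v)) ^ c)) =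
    single (N : ℤ) (algebraMap _ _ (Ideal.Quotient.mk (Ideal.span {fh}) (MvPolynomial.X (some v)) ^ c)) := by
  have h := hβ (MvPolynomial.X (some v) ^ c) N (by
    have h1 := (MvPolynomial.isWeightedHomogeneous_X k (fun o : Option (Fin n) => o.elim (-1 : ℤ) (fun j => (w j : ℤ)))
      (some v)).pow c
    rwa [Option.elim_some, nsmul_eq_mul, ← Nat.cast_mul, hcN] at h1)
  rwa [map_pow (Ideal.Quotient.mk (Ideal.span {fh}))] at h

/-- `1/X_v^c` is homogeneous of degree `−N`. [folklore] -/
theorem coaction_invSelf : β (IsLocalization.Away.invSelf (Ideal.Quotient.mk (Ideal.span {fh}) (MvPolynomial.X (some v)) ^ c)) =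
    single (-(N : ℤ)) (IsLocalization.Away.invSelf (S := Localization.Away (Ideal.Quotient.mk (Ideal.span {fh})
      (MvPolynomial.X (some v)) ^ c)) (Ideal.Quotient.mk (Ideal.span {fh}) (MvPolynomial.X (some v)) ^ c)) := by
  have hU := coaction_U w fh v N c hcN β hβ
  have h1 : β (algebraMap _ _ (Ideal.Quotient.mk (Ideal.span {fh}) (MvPolynomial.X (some v)) ^ c)) *
      β (IsLocalization.Away.invSelf (Ideal.Quotient.mk (Ideal.span {fh}) (MvPolynomial.X (some v)) ^ c)) = 1 := by
    rw [← map_mul, IsLocalization.Away.mul_invSelf, map_one]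
  have h2 : single (N : ℤ) (algebraMap _ (Localization.Away (Ideal.Quotient.mk (Ideal.span {fh}) (MvPolynomial.X (some v)) ^ c))
      (Ideal.Quotient.mk (Ideal.span {fh}) (MvPolynomial.X (some v)) ^ c)) *
      single (-(N : ℤ)) (IsLocalization.Away.invSelf (S := Localization.Away (Ideal.Quotient.mk (Ideal.span {fh})
        (MvPolynomial.X (some v)) ^ c)) (Ideal.Quotient.mk (Ideal.span {fh}) (MvPolynomial.X (some v)) ^ c)) = 1 := by
    rw [single_mul_single, add_neg_cancel, IsLocalization.Away.mul_invSelf]; rfl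
  calc β (IsLocalization.Away.invSelf (Ideal.Quotient.mk (Ideal.span {fh}) (MvPolynomial.X (some v)) ^ c))
      = β (IsLocalization.Away.invSelf _) * (single (N : ℤ) (algebraMap _ (Localization.Away (Ideal.Quotient.mk
          (Ideal.span {fh}) (MvPolynomial.X (some v)) ^ c)) (Ideal.Quotient.mk (Ideal.span {fh}) (MvPolynomial.X (some v)) ^ c)) *
          single (-(N : ℤ)) (IsLocalization.Away.invSelf (S := Localization.Away (Ideal.Quotient.mk (Ideal.span {fh})
            (MvPolynomial.X (some v)) ^ c)) (Ideal.Quotient.mk (Ideal.span {fh}) (MvPolynomial.X (some v)) ^ c))) := by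
        rw [h2, mul_one]
    _ = _ := by rw [← hU, ← mul_assoc, mul_comm (β _) (β _), h1, one_mul]

/-- The monomial fraction `(r X^e/1)·(1/X_v^c)^j` is homogeneous of degree `w·(e∘some) − e(none) − jN`. [folklore] -/
theorem coaction_term (e : Option (Fin n) →₀ ℕ) (r : k) (j : ℕ) :
    β (algebraMap _ _ (Ideal.Quotient.mk (Ideal.span {fh}) (MvPolynomial.monomial e r)) *
        IsLocalization.Away.invSelf (Ideal.Quotient.mk (Ideal.span {fh}) (MvPolynomial.X (some v)) ^ c) ^ j) =
      single ((Finsupp.weight w e.some : ℤ) - e none - j * N)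
        (algebraMap _ _ (Ideal.Quotient.mk (Ideal.span {fh}) (MvPolynomial.monomial e r)) *
          IsLocalization.Away.invSelf (Ideal.Quotient.mk (Ideal.span {fh}) (MvPolynomial.X (some v)) ^ c) ^ j) := by
  rw [map_mul, map_pow, hβ _ _ (MvPolynomial.isWeightedHomogeneous_monomial _ e r (weight_option w e)),
    coaction_invSelf w fh v N c hcN β hβ, single_pow, single_mul_single]
  congr 1
  ring

/-- **Degree-zero elements**: if `(ā/1)(1/X_v^c)^j` has degree `0` (`β b = b·T^0`), it is the sum of its monomial fractions of
degree `0`, i.e. those `c_e X^e/X_v^{cj}` with `w·(e∘some) − e(none) = jN`. [folklore] -/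
theorem eq_sum_of_degZero (j : ℕ) (a : MvPolynomial (Option (Fin n)) k)
    (hb : β (algebraMap _ (Localization.Away (Ideal.Quotient.mk (Ideal.span {fh}) (MvPolynomial.X (some v)) ^ c))
        (Ideal.Quotient.mk (Ideal.span {fh}) a) * IsLocalization.Away.invSelf (Ideal.Quotient.mk (Ideal.span {fh}) (MvPolynomial.X (some v)) ^ c) ^ j) =
      single 0 (algebraMap _ (Localization.Away (Ideal.Quotient.mk (Ideal.span {fh}) (MvPolynomial.X (some v)) ^ c))
        (Ideal.Quotient.mk (Ideal.span {fh}) a) * IsLocalization.Away.invSelf (Ideal.Quotient.mk (Ideal.span {fh}) (MvPolynomial.X (some v)) ^ c) ^ j)) :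
    algebraMap _ (Localization.Away (Ideal.Quotient.mk (Ideal.span {fh}) (MvPolynomial.X (some v)) ^ c))
        (Ideal.Quotient.mk (Ideal.span {fh}) a) * IsLocalization.Away.invSelf (Ideal.Quotient.mk (Ideal.span {fh}) (MvPolynomial.X (some v)) ^ c) ^ j =
      ∑ e ∈ a.support.filter (fun e => (Finsupp.weight w e.some : ℤ) - e none - j * N = 0),
        algebraMap _ _ (Ideal.Quotient.mk (Ideal.span {fh}) (MvPolynomial.monomial e (MvPolynomial.coeff e a))) *
          IsLocalization.Away.invSelf (Ideal.Quotient.mk (Ideal.span {fh}) (MvPolynomial.X (some v)) ^ c) ^ j := by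
  classical
  have hsum : algebraMap _ (Localization.Away (Ideal.Quotient.mk (Ideal.span {fh}) (MvPolynomial.X (some v)) ^ c))
      (Ideal.Quotient.mk (Ideal.span {fh}) a) * IsLocalization.Away.invSelf (Ideal.Quotient.mk (Ideal.span {fh}) (MvPolynomial.X (some v)) ^ c) ^ j =
      ∑ e ∈ a.support, algebraMap _ _ (Ideal.Quotient.mk (Ideal.span {fh}) (MvPolynomial.monomial e (MvPolynomial.coeff e a))) *
        IsLocalization.Away.invSelf (Ideal.Quotient.mk (Ideal.span {fh}) (MvPolynomial.X (some v)) ^ c) ^ j := by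
    conv_lhs => rw [MvPolynomial.as_sum a]
    rw [map_sum, map_sum, Finset.sum_mul]
  rw [hsum, map_sum, Finset.sum_congr rfl (fun e _ => coaction_term w fh v N c hcN β hβ e (MvPolynomial.coeff e a) j)] at hb
  have h0 := congrArg (fun x : (Localization.Away (Ideal.Quotient.mk (Ideal.span {fh}) (MvPolynomial.X (some v)) ^ c))[T;T⁻¹] =>
    x.coeff 0) hb
  rw [AddMonoidAlgebra.coeff_sum, Finsupp.finsetSum_apply, AddMonoidAlgebra.coeff_single, Finsupp.single_eq_same] at h0
  rw [hsum, ← h0, Finset.sum_filter]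
  refine Finset.sum_congr rfl fun e _ => ?_
  rw [AddMonoidAlgebra.coeff_single, Finsupp.single_apply]

end Coaction

end Summit.ResolutionOfSingularities.ResolutionOfSingularities.Theorems.FInjectiveMacaulayfication.FilteredChartSubst

end
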